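import Summits.CriticalPhenomena.PercolationContinuityZ3.Theorems.PercNearOneGluingNoHeavyLowerTailSahiCubeNonAbsorbing

/-!
# `NoHeavyLowerTail` (stmt-CriticalPhenomena-4575) — Sahi's `E_5 ≥ 0` on the non-absorbing quintuples of up-sets of `{0,1}^4`, row A
# (kernel evaluation of the five-copy digit test)

Support file, seat `prim-l12-p5` (gen 5), `--supports stmt-CriticalPhenomena-4575`, COMPUTATIONAL (`native_decide`, like
`SahiHereditaryMeetAbsorption.checkNA_four`).  One ROW of the order-5 residual check of `…SahiCubeNonAbsorbing` on the four-dimensional cube: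
first bitmask ≤ 61128 (10 648 non-absorbing quintuples); digit base `2^28` (`coefBound 4 5 = 125 829 120 < 2^27`), positions in base `6`,
Kronecker numbers of the 168 increasing bitmasks from the table `ktTab 28 6 4`.  The enumeration visits the sorted quintuples of increasing bitmasks,
pruning every prefix with an absorbing member; over all three rows it runs the digit test on exactly the 31 968 non-absorbing quintuple-multisets
(seat pre-check `code/e56_kron.py`: all 41.4 M fibre sums `≥ 0`, max `16 580`).  Nothing else is asserted; assembled in `…SahiConjectureCubeFour`.
-/

namespace Summit.CriticalPhenomena.PercolationContinuityZ3.Theorems.NCopyCert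

open SahiC3Cube OneCutCert

/-- **Row A of the order-5 residual check on `{0,1}^4`** (first bitmask ≤ 61128 (10 648 non-absorbing quintuples)): every sorted quintuple of increasing bitmasks in the row
has an absorbing prefix or passes the five-copy digit test. [this file] -/
theorem checkR5W_cube_four_rowA :
    checkR5W 4 (ktLook 28 6 4 (ktTab 28 6 4)) (krTB 28 6 4 (fullN 4)) (maskN 28 (6 ^ 4)) (maskN 28 (6 ^ 4))
      (fun a => decide (a ≤ 61128)) = true := by
  native_decide

end Summit.CriticalPhenomena.PercolationContinuityZ3.Theorems.NCopyCert
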